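import Mathlib

/-!
# The 28 leading digits of the edge unit: the printed counts and the case coverage (pub-hsemireg, S4-PUSH corner 2)

Kernel leg of seat s4-search-2 gen 16 (cell `pub-hsemireg`) for the ONE enumerative GIVEN left in the (2,2,3,3,3,3)
edge unit's CLASS-DEAD route after gens 13–15 (`s4push/search-2/g15/READING-GUIDE.md`, PEN-NOTE g15 DELTA 6): «the
enumeration of the 28 non-degenerate leading digits with their parity ∕ functional data».  Memo of record:
`s4push/search-2/g11/LIFT2-search-2-g11.md` («S2-21») §2 ∕ §5 LEMMAS A(a), D(a); tree companions
`DegreeSixSecondDigit` (`T3_leading_edge`, `T2_leading`, `obstruction` and the coverage paragraph of its docstring),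
`DividedSquareLemma` (Pfaffian convention), and the keyed rows `LeadingDigitRemainder` (`lemmaD_a_reading`,
`lemmaA_a_chain`, `edge_digit_equation`) ∕ `TwoAdicReadings` (`lemmaA_a_reading`) of gen 15.

**Setting.**  A leading digit of the edge unit is the reduction mod 2 of the class 2-form on the slot pair `0, 1`,
`C = β₀₁h₀ + β₂₃h₁ + N`, `N = n₁l₁ + n₂l₂ + n₃l₃ + n₄l₄` (`h₀ = x₀x₁`, `h₁ = x₂x₃`, cross lines `l₁ = x₀x₂`,
`l₂ = x₀x₃`, `l₃ = x₁x₂`, `l₄ = x₁x₃`), i.e. an alternating form on `𝔽₂⁴` with the six coordinates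
`(β₀₁, β₂₃, n₁, n₂, n₃, n₄)`; it is NON-DEGENERATE iff its Pfaffian `β₀₁β₂₃ + (n₂n₃ − n₁n₄)` is odd (the tree's
`hp : β₀₁ * β₂₃ + (n₂ * n₃ - n₁ * n₄) = 2 * p + 1`; signs vanish mod 2).  A cross-line functional is
`F = c₁l₁ + ⋯ + c₄l₄` with pairing `ϖ = c₂n₃ + c₃n₂ − c₁n₄ − c₄n₁` (`F·N = ϖ·h₀h₁`, the tree's `hϖ`).
The memo sorts the 28 non-degenerate digits into: the twelve with `β₀₁ + β₂₃` odd ((V)-kills at depth 1, LEMMA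
D(a) — `lemmaD_a_reading`, hypothesis `hr : β₀₁ + β₂₃ = 2r + 1`); fifteen of the other sixteen, which admit a
functional with EVEN pairing `β₂₃ + ϖ = 2m` (LEMMA A(a) inconsistent direction — `lemmaA_a_chain`, hypothesis `hm`);
and the sixteenth `C̄ = H̄ = h̄₀ + h̄₁` (LEMMA A(a) consistent direction → clause → LEMMA B — `edge_digit_equation` …
`lemmaB_reading`).

**Proved here (theorems only, count-neutral; no `def`).**
§1 (`𝔽₂` model, `decide`): the printed counts as kernel facts — `card_leadingDigits` (28 non-degenerate of the 64),
`card_depthOne_kills` (12), `card_depthOne_survivors` (16), `card_survivors_slots_even` (6, functional `F = 0`),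
`card_survivors_slots_odd_cross` (9, a complementary cross line), `survivors_uncovered_eq` (the survivors with NO
even-pairing functional are exactly `{H̄}`), `card_survivors_covered` (15), the case coverage `coverage_mod_two`
and how the cases meet (`coverage_mod_two_meet`); the dictionary `ℤ → 𝔽₂` (`pfaffian_mod_two`, `slots_mod_two_of_odd`).
§2 (over `ℤ`, explicit witnesses): `trichotomy` — for ANY integers `β₀₁ β₂₃ n₁ … n₄` (no Pfaffian hypothesis is
needed for the case split itself): EITHER `β₀₁ + β₂₃ = 2r + 1` (the shape of `lemmaD_a_reading`'s `hr`), OR there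
are integers `c₁ … c₄, m` with `β₂₃ + (c₂n₃ + c₃n₂ − c₁n₄ − c₄n₁) = 2m` (the shape of `lemmaA_a_chain`'s `hϖ ∕ hm`;
the witness is `F = 0` or ONE cross line, `trichotomy_sharp`), OR `β₀₁, β₂₃` are odd and every `nᵢ` is even,
i.e. `C = H + 2A` for the integral 2-form `A = a₀h₀ + a₁h₁ + Σ eᵢlᵢ` (`C̄ = H̄`; `recentre`).  §3: the same with all
integers cast into an arbitrary ring (`trichotomy_cast`), which is how the keyed rows consume them (parameters are
elements of the 2-vector subalgebra `Λ ⊂ ExteriorAlgebra ℤ M`; integer casts lie in every subalgebra).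

With this file the first GIVEN of the edge unit's route («criterion at k = 2 ⇒ digit equation (D) ⇒ clause (E) ⇒
lemmaB's form (F) ⇒ v₂(T₃) = 8 < 10 (A); the other 27 digits by D») is a kernel fact: every integral leading digit
falls under one of the three branch theorems, and the memo's numbers 28 ∕ 12 ∕ 16 = 6 + 9 + 1 ∕ 15 are `decide`d.
NOT here: the composition itself for one and the same integral 2-form `B` (it needs the registered closed forms of the
divided powers of `B` on all three branches at once — the second GIVEN), LEMMA C, the `E = ∅` units, census counts.
Honest framing: finite combinatorics and parity bookkeeping (theorems only, count-neutral); a kernel check of one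
enumerative step of a CLASS-LEVEL necessary-condition sieve (CRITERION L) at the special fibre `E⁶`; no object, no
`σ` computation, no Hodge statement; nothing here bears on HC ∕ HC_CM ∕ HC_AV.
-/

namespace Summit.Ventures.HSemireg.LeadingDigitCoverage

section ModTwo

/-! ### 1. The `𝔽₂` model: digits as six bits `d = (β₀₁, β₂₃, n₁, n₂, n₃, n₄)`, the printed counts

A digit is `d : Fin 6 → ZMod 2` with `d 0 = β̄₀₁`, `d 1 = β̄₂₃`, `d 2 = n̄₁` (coefficient of `l̄₁ = x₀x₂`),
`d 3 = n̄₂` (`l̄₂ = x₀x₃`), `d 4 = n̄₃` (`l̄₃ = x₁x₂`), `d 5 = n̄₄` (`l̄₄ = x₁x₃`); Pfaffian mod 2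
`= d 0 * d 1 + d 3 * d 4 + d 2 * d 5`; a functional is `c : Fin 4 → ZMod 2` (`c i` the coefficient of `l̄_{i+1}`)
with pairing mod 2 `ϖ̄ = c 1 * d 4 + c 2 * d 3 + c 0 * d 5 + c 3 * d 2`. -/

/-- **28.** Of the `2⁶ = 64` alternating forms on `𝔽₂⁴` (digits on the slot pair `0, 1`), exactly 28 are
non-degenerate (odd Pfaffian) — the memo's «28 non-degenerate leading digits» (S2-21 §2). -/
theorem card_leadingDigits :
    (Finset.univ.filter fun d : Fin 6 → ZMod 2 =>
      d 0 * d 1 + d 3 * d 4 + d 2 * d 5 = 1).card = 28 := by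
  decide

/-- **12.** Exactly 12 non-degenerate digits have `β₀₁ + β₂₃` odd — the depth-1 (V)-kills `(k, v, g) = (3, 7, 8)`
of LEMMA D(a) (`DegreeSixSecondDigit.T3_leading_edge`: `v₂(T₃(C)) = 7` iff `β₀₁ + β₂₃` odd; kernel reading with
remainder `LeadingDigitRemainder.lemmaD_a_reading`). -/
theorem card_depthOne_kills :
    (Finset.univ.filter fun d : Fin 6 → ZMod 2 =>
      d 0 * d 1 + d 3 * d 4 + d 2 * d 5 = 1 ∧ d 0 + d 1 = 1).card = 12 := by
  decide

/-- **16.** Exactly 16 non-degenerate digits survive depth 1 (`β₀₁ ≡ β₂₃ mod 2`). -/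
theorem card_depthOne_survivors :
    (Finset.univ.filter fun d : Fin 6 → ZMod 2 =>
      d 0 * d 1 + d 3 * d 4 + d 2 * d 5 = 1 ∧ d 0 = d 1).card = 16 := by
  decide

/-- **6.** Six survivors have both slot coefficients even (`β̄₀₁ = β̄₂₃ = 0`): for these the functional `F = 0`
(`ϖ = 0`) has even pairing `β₂₃ + ϖ` (first case of the coverage paragraph of `DegreeSixSecondDigit.obstruction`). -/
theorem card_survivors_slots_even :
    (Finset.univ.filter fun d : Fin 6 → ZMod 2 =>
      d 0 * d 1 + d 3 * d 4 + d 2 * d 5 = 1 ∧ d 0 = 0 ∧ d 1 = 0).card = 6 := by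
  decide

/-- **9.** Nine survivors have both slot coefficients odd and a non-zero cross part `N̄ ≠ 0`: for these the cross
line complementary to an odd `nᵢ` is a functional with odd `ϖ`, so `β₂₃ + ϖ` is even (second case of the coverage
paragraph). -/
theorem card_survivors_slots_odd_cross :
    (Finset.univ.filter fun d : Fin 6 → ZMod 2 =>
      d 0 * d 1 + d 3 * d 4 + d 2 * d 5 = 1 ∧ d 0 = 1 ∧ d 1 = 1 ∧
        (d 2 = 1 ∨ d 3 = 1 ∨ d 4 = 1 ∨ d 5 = 1)).card = 9 := by
  decide

/-- **15.** Exactly 15 of the 16 survivors admit a cross-line functional `c` with EVEN pairing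
`β̄₂₃ + ϖ̄ = 0` — the memo's «15 ∕ 16 inconsistent» (LEMMA A(a), inconsistent direction; kernel chain
`LeadingDigitRemainder.lemmaA_a_chain`). -/
theorem card_survivors_covered :
    (Finset.univ.filter fun d : Fin 6 → ZMod 2 =>
      d 0 * d 1 + d 3 * d 4 + d 2 * d 5 = 1 ∧ d 0 = d 1 ∧
        ∃ c : Fin 4 → ZMod 2, d 1 + (c 1 * d 4 + c 2 * d 3 + c 0 * d 5 + c 3 * d 2) = 0).card = 15 := by
  decide

/-- **1.** The survivors admitting NO even-pairing functional are exactly `{H̄}` = `(1, 1, 0, 0, 0, 0)` — the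
sixteenth digit `C̄ = h̄₀ + h̄₁`, the only one with a first digit (LEMMA A(a), consistent direction;
`LeadingDigitRemainder.edge_digit_equation` → `DigitSpaceClause.digitSpace_clause` →
`EdgeDigitParametrisation.edge_first_digit_parametrisation` → `TwoAdicReadings.lemmaB_reading`). -/
theorem survivors_uncovered_eq :
    (Finset.univ.filter fun d : Fin 6 → ZMod 2 =>
      d 0 * d 1 + d 3 * d 4 + d 2 * d 5 = 1 ∧ d 0 = d 1 ∧
        ∀ c : Fin 4 → ZMod 2, d 1 + (c 1 * d 4 + c 2 * d 3 + c 0 * d 5 + c 3 * d 2) ≠ 0) =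
      {![1, 1, 0, 0, 0, 0]} := by
  decide

/-- **Coverage mod 2 (28 = 12 + 15 + 1).** Every non-degenerate digit is a depth-1 (V)-kill (`β̄₀₁ + β̄₂₃ = 1`),
or admits a functional with even pairing, or is `H̄`. -/
theorem coverage_mod_two (d : Fin 6 → ZMod 2) (hPf : d 0 * d 1 + d 3 * d 4 + d 2 * d 5 = 1) :
    d 0 + d 1 = 1 ∨
      (∃ c : Fin 4 → ZMod 2, d 1 + (c 1 * d 4 + c 2 * d 3 + c 0 * d 5 + c 3 * d 2) = 0) ∨
      d = ![1, 1, 0, 0, 0, 0] := by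
  revert d hPf
  decide

/-- How the cases meet on non-degenerate digits (so that the counts add up, `28 = 12 + 16`,
`16 = 15 + 1`): `H̄` is neither a (V)-kill nor covered by a functional, and a digit covered by NO functional and
not a (V)-kill is `H̄`.  (A (V)-kill may well admit an even-pairing functional too — both branch theorems then
apply; the memo files it under LEMMA D(a).) -/
theorem coverage_mod_two_meet (d : Fin 6 → ZMod 2) (hPf : d 0 * d 1 + d 3 * d 4 + d 2 * d 5 = 1) :
    (d = ![1, 1, 0, 0, 0, 0] → d 0 + d 1 ≠ 1 ∧
      ¬ ∃ c : Fin 4 → ZMod 2, d 1 + (c 1 * d 4 + c 2 * d 3 + c 0 * d 5 + c 3 * d 2) = 0) ∧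
    ((d 0 + d 1 ≠ 1 ∧ ¬ ∃ c : Fin 4 → ZMod 2, d 1 + (c 1 * d 4 + c 2 * d 3 + c 0 * d 5 + c 3 * d 2) = 0) →
      d = ![1, 1, 0, 0, 0, 0]) := by
  revert d hPf
  decide

end ModTwo

section Integers

/-! ### 2. Over `ℤ`: the case split with explicit witnesses, in the shape of the keyed rows' hypotheses -/

/-- **Trichotomy of integral leading digits (the coverage GIVEN, over `ℤ`).**  For ANY integers
`β₀₁ β₂₃ n₁ n₂ n₃ n₄` (coefficients of `C = β₀₁h₀ + β₂₃h₁ + n₁l₁ + n₂l₂ + n₃l₃ + n₄l₄`; no Pfaffian hypothesis is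
needed for the split): (1) `β₀₁ + β₂₃ = 2r + 1` — hypothesis `hr` of `LeadingDigitRemainder.lemmaD_a_reading`;
or (2) some cross-line functional `(c₁, c₂, c₃, c₄)` has even pairing, `β₂₃ + (c₂n₃ + c₃n₂ − c₁n₄ − c₄n₁) = 2m` —
hypotheses `hϖ`, `hm` of `LeadingDigitRemainder.lemmaA_a_chain` ∕ `TwoAdicReadings.lemmaA_a_reading`; or (3) `β₀₁`,
`β₂₃` are odd and all `nᵢ` even — `C ≡ H mod 2`, the digit `H̄` of `LeadingDigitRemainder.edge_digit_equation`
(see `recentre`).  Witnesses: (2) with `F = 0` when `β₂₃` is even, with the cross line complementary to an odd `nᵢ`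
when `β₀₁, β₂₃` are odd (`l₄ ↔ n₁`, `l₃ ↔ n₂`, `l₂ ↔ n₃`, `l₁ ↔ n₄`). -/
theorem trichotomy (β₀₁ β₂₃ n₁ n₂ n₃ n₄ : ℤ) :
    (∃ r : ℤ, β₀₁ + β₂₃ = 2 * r + 1) ∨
    (∃ c₁ c₂ c₃ c₄ m : ℤ, β₂₃ + (c₂ * n₃ + c₃ * n₂ - c₁ * n₄ - c₄ * n₁) = 2 * m) ∨
    (∃ a₀ a₁ e₁ e₂ e₃ e₄ : ℤ, β₀₁ = 2 * a₀ + 1 ∧ β₂₃ = 2 * a₁ + 1 ∧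
      n₁ = 2 * e₁ ∧ n₂ = 2 * e₂ ∧ n₃ = 2 * e₃ ∧ n₄ = 2 * e₄) := by
  rcases Int.even_or_odd' β₂₃ with ⟨a₁, ha₁ | ha₁⟩
  · -- β₂₃ even: the zero functional
    exact Or.inr (Or.inl ⟨0, 0, 0, 0, a₁, by rw [ha₁]; ring⟩)
  rcases Int.even_or_odd' β₀₁ with ⟨a₀, ha₀ | ha₀⟩
  · -- β₀₁ even, β₂₃ odd: a (V)-kill
    exact Or.inl ⟨a₀ + a₁, by rw [ha₀, ha₁]; ring⟩
  -- both odd: a complementary cross line for an odd nᵢ, else case (3)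
  rcases Int.even_or_odd' n₁ with ⟨e₁, he₁ | he₁⟩
  swap
  · exact Or.inr (Or.inl ⟨0, 0, 0, -1, a₁ + e₁ + 1, by rw [ha₁, he₁]; ring⟩)
  rcases Int.even_or_odd' n₂ with ⟨e₂, he₂ | he₂⟩
  swap
  · exact Or.inr (Or.inl ⟨0, 0, 1, 0, a₁ + e₂ + 1, by rw [ha₁, he₂]; ring⟩)
  rcases Int.even_or_odd' n₃ with ⟨e₃, he₃ | he₃⟩
  swap
  · exact Or.inr (Or.inl ⟨0, 1, 0, 0, a₁ + e₃ + 1, by rw [ha₁, he₃]; ring⟩)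
  rcases Int.even_or_odd' n₄ with ⟨e₄, he₄ | he₄⟩
  swap
  · exact Or.inr (Or.inl ⟨-1, 0, 0, 0, a₁ + e₄ + 1, by rw [ha₁, he₄]; ring⟩)
  exact Or.inr (Or.inr ⟨a₀, a₁, e₁, e₂, e₃, e₄, ha₀, ha₁, he₁, he₂, he₃, he₄⟩)

/-- **The same split, sharp form used by the memo:** outside case (3) and the (V)-kills, the functional may be
taken to be `F = 0` or a SINGLE cross line with coefficient `±1` (`DegreeSixSecondDigit.obstruction`'s coverage
paragraph: «`β₀₁, β₂₃` even ⟹ take `F = 0`; `β₀₁, β₂₃` odd and `C̄ ≠ H̄` ⟹ … take `F` the complementary cross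
line»).  Stated as: each `cᵢ ∈ {−1, 0, 1}` and at most one is non-zero. -/
theorem trichotomy_sharp (β₀₁ β₂₃ n₁ n₂ n₃ n₄ : ℤ) :
    (∃ r : ℤ, β₀₁ + β₂₃ = 2 * r + 1) ∨
    (∃ c₁ c₂ c₃ c₄ m : ℤ, β₂₃ + (c₂ * n₃ + c₃ * n₂ - c₁ * n₄ - c₄ * n₁) = 2 * m ∧
      (c₁ = 0 ∨ c₁ = 1 ∨ c₁ = -1) ∧ (c₂ = 0 ∨ c₂ = 1 ∨ c₂ = -1) ∧ (c₃ = 0 ∨ c₃ = 1 ∨ c₃ = -1) ∧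
      (c₄ = 0 ∨ c₄ = 1 ∨ c₄ = -1) ∧ c₁ * c₂ = 0 ∧ c₁ * c₃ = 0 ∧ c₁ * c₄ = 0 ∧ c₂ * c₃ = 0 ∧
      c₂ * c₄ = 0 ∧ c₃ * c₄ = 0) ∨
    (∃ a₀ a₁ e₁ e₂ e₃ e₄ : ℤ, β₀₁ = 2 * a₀ + 1 ∧ β₂₃ = 2 * a₁ + 1 ∧
      n₁ = 2 * e₁ ∧ n₂ = 2 * e₂ ∧ n₃ = 2 * e₃ ∧ n₄ = 2 * e₄) := by
  rcases Int.even_or_odd' β₂₃ with ⟨a₁, ha₁ | ha₁⟩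
  · exact Or.inr (Or.inl ⟨0, 0, 0, 0, a₁, by rw [ha₁]; ring, by omega⟩)
  rcases Int.even_or_odd' β₀₁ with ⟨a₀, ha₀ | ha₀⟩
  · exact Or.inl ⟨a₀ + a₁, by rw [ha₀, ha₁]; ring⟩
  rcases Int.even_or_odd' n₁ with ⟨e₁, he₁ | he₁⟩
  swap
  · exact Or.inr (Or.inl ⟨0, 0, 0, -1, a₁ + e₁ + 1, by rw [ha₁, he₁]; ring, by omega⟩)
  rcases Int.even_or_odd' n₂ with ⟨e₂, he₂ | he₂⟩
  swap
  · exact Or.inr (Or.inl ⟨0, 0, 1, 0, a₁ + e₂ + 1, by rw [ha₁, he₂]; ring, by omega⟩)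
  rcases Int.even_or_odd' n₃ with ⟨e₃, he₃ | he₃⟩
  swap
  · exact Or.inr (Or.inl ⟨0, 1, 0, 0, a₁ + e₃ + 1, by rw [ha₁, he₃]; ring, by omega⟩)
  rcases Int.even_or_odd' n₄ with ⟨e₄, he₄ | he₄⟩
  swap
  · exact Or.inr (Or.inl ⟨-1, 0, 0, 0, a₁ + e₄ + 1, by rw [ha₁, he₄]; ring, by omega⟩)
  exact Or.inr (Or.inr ⟨a₀, a₁, e₁, e₂, e₃, e₄, ha₀, ha₁, he₁, he₂, he₃, he₄⟩)

/-- **The Pfaffian is not needed for the split, but it sorts case (3):** if `β₀₁, β₂₃` are odd and all `nᵢ` are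
even then the Pfaffian `β₀₁β₂₃ + (n₂n₃ − n₁n₄)` is automatically odd (`H̄` IS non-degenerate), whereas in cases
(1)–(2) non-degeneracy is an independent hypothesis (the tree's `hp`). -/
theorem odd_pfaffian_of_recentre (β₀₁ β₂₃ n₁ n₂ n₃ n₄ a₀ a₁ e₁ e₂ e₃ e₄ : ℤ) (h₀ : β₀₁ = 2 * a₀ + 1)
    (h₁ : β₂₃ = 2 * a₁ + 1) (g₁ : n₁ = 2 * e₁) (g₂ : n₂ = 2 * e₂) (g₃ : n₃ = 2 * e₃) (g₄ : n₄ = 2 * e₄) :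
    ∃ p : ℤ, β₀₁ * β₂₃ + (n₂ * n₃ - n₁ * n₄) = 2 * p + 1 :=
  ⟨2 * a₀ * a₁ + a₀ + a₁ + 2 * (e₂ * e₃ - e₁ * e₄), by subst h₀ h₁ g₁ g₂ g₃ g₄; ring⟩

/-- **Case (3) re-centred: `C = H + 2A`.**  In ANY ring, with the slots and cross lines as arbitrary elements
`h₀ h₁ l₁ … l₄`: if `β₀₁ = 2a₀ + 1`, `β₂₃ = 2a₁ + 1`, `nᵢ = 2eᵢ`, then
`β₀₁h₀ + β₂₃h₁ + (n₁l₁ + ⋯ + n₄l₄) = (h₀ + h₁) + 2·(a₀h₀ + a₁h₁ + e₁l₁ + ⋯ + e₄l₄)` — so a completion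
`C + 2X + 4Y` of such a digit is the completion `H + 2(X + A) + 4Y` of `H = h₀ + h₁`, the leading digit of
`LeadingDigitRemainder.edge_digit_equation` (all coefficients integers cast into the ring). -/
theorem recentre {A : Type*} [Ring A] (h₀ h₁ l₁ l₂ l₃ l₄ : A) (β₀₁ β₂₃ n₁ n₂ n₃ n₄ a₀ a₁ e₁ e₂ e₃ e₄ : ℤ)
    (hβ₀₁ : β₀₁ = 2 * a₀ + 1) (hβ₂₃ : β₂₃ = 2 * a₁ + 1) (g₁ : n₁ = 2 * e₁) (g₂ : n₂ = 2 * e₂)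
    (g₃ : n₃ = 2 * e₃) (g₄ : n₄ = 2 * e₄) :
    (β₀₁ : A) * h₀ + (β₂₃ : A) * h₁ + ((n₁ : A) * l₁ + (n₂ : A) * l₂ + (n₃ : A) * l₃ + (n₄ : A) * l₄) =
      (h₀ + h₁) + 2 * ((a₀ : A) * h₀ + (a₁ : A) * h₁ +
        ((e₁ : A) * l₁ + (e₂ : A) * l₂ + (e₃ : A) * l₃ + (e₄ : A) * l₄)) := by
  subst hβ₀₁ hβ₂₃ g₁ g₂ g₃ g₄
  push_cast
  noncomm_ring

end Integers

section Cast

/-! ### 3. The witnesses cast into an arbitrary ring (how the keyed rows consume them) -/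

/-- **Trichotomy with all integers cast into a ring `A`.**  The keyed rows take `β₀₁, β₂₃, nᵢ, cᵢ, r, m, p` as
elements of the 2-vector subalgebra `Λ ⊂ ExteriorAlgebra ℤ M` with the parity hypotheses as equations there; for
integral data these are the casts of `trichotomy`'s equations (integer casts lie in every subalgebra, so the
membership hypotheses `mr, mm, mcᵢ, …` are free). -/
theorem trichotomy_cast (A : Type*) [Ring A] (β₀₁ β₂₃ n₁ n₂ n₃ n₄ : ℤ) :
    (∃ r : ℤ, (β₀₁ : A) + (β₂₃ : A) = 2 * (r : A) + 1) ∨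
    (∃ c₁ c₂ c₃ c₄ m : ℤ,
      (β₂₃ : A) + ((c₂ : A) * (n₃ : A) + (c₃ : A) * (n₂ : A) - (c₁ : A) * (n₄ : A) - (c₄ : A) * (n₁ : A)) =
        2 * (m : A)) ∨
    (∃ a₀ a₁ e₁ e₂ e₃ e₄ : ℤ, (β₀₁ : A) = 2 * (a₀ : A) + 1 ∧ (β₂₃ : A) = 2 * (a₁ : A) + 1 ∧
      (n₁ : A) = 2 * (e₁ : A) ∧ (n₂ : A) = 2 * (e₂ : A) ∧ (n₃ : A) = 2 * (e₃ : A) ∧ (n₄ : A) = 2 * (e₄ : A)) := by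
  rcases trichotomy β₀₁ β₂₃ n₁ n₂ n₃ n₄ with ⟨r, hr⟩ | ⟨c₁, c₂, c₃, c₄, m, hm⟩ |
      ⟨a₀, a₁, e₁, e₂, e₃, e₄, h₀, h₁, g₁, g₂, g₃, g₄⟩
  · exact Or.inl ⟨r, by exact_mod_cast congrArg (Int.cast : ℤ → A) hr⟩
  · exact Or.inr (Or.inl ⟨c₁, c₂, c₃, c₄, m, by exact_mod_cast congrArg (Int.cast : ℤ → A) hm⟩)
  · refine Or.inr (Or.inr ⟨a₀, a₁, e₁, e₂, e₃, e₄, ?_, ?_, ?_, ?_, ?_, ?_⟩)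
    · exact_mod_cast congrArg (Int.cast : ℤ → A) h₀
    · exact_mod_cast congrArg (Int.cast : ℤ → A) h₁
    · exact_mod_cast congrArg (Int.cast : ℤ → A) g₁
    · exact_mod_cast congrArg (Int.cast : ℤ → A) g₂
    · exact_mod_cast congrArg (Int.cast : ℤ → A) g₃
    · exact_mod_cast congrArg (Int.cast : ℤ → A) g₄

/-- **Dictionary `ℤ → 𝔽₂` for the Pfaffian:** the tree's non-degeneracy hypothesis `β₀₁β₂₃ + (n₂n₃ − n₁n₄) = 2p + 1`
says exactly that the digit's image in the `𝔽₂` model of §1 has Pfaffian `1`. -/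
theorem pfaffian_mod_two (β₀₁ β₂₃ n₁ n₂ n₃ n₄ p : ℤ) (hp : β₀₁ * β₂₃ + (n₂ * n₃ - n₁ * n₄) = 2 * p + 1) :
    (β₀₁ : ZMod 2) * (β₂₃ : ZMod 2) + (n₂ : ZMod 2) * (n₃ : ZMod 2) + (n₁ : ZMod 2) * (n₄ : ZMod 2) = 1 := by
  have h : ((β₀₁ * β₂₃ + (n₂ * n₃ - n₁ * n₄) : ℤ) : ZMod 2) = ((2 * p + 1 : ℤ) : ZMod 2) := by rw [hp]
  have e2 : (2 : ZMod 2) = 0 := by decide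
  simp only [Int.cast_add, Int.cast_mul, Int.cast_sub, Int.cast_one, Int.cast_ofNat, e2, zero_mul,
    zero_add] at h
  have e1 : ∀ z w : ZMod 2, z - w = z + w := by decide
  rw [e1, ← add_assoc] at h
  exact h

/-- **Dictionary for case (1):** `β₀₁ + β₂₃ = 2r + 1` ⟹ `β̄₀₁ + β̄₂₃ = 1` (a (V)-kill in the `𝔽₂` model). -/
theorem slots_mod_two_of_odd (β₀₁ β₂₃ r : ℤ) (hr : β₀₁ + β₂₃ = 2 * r + 1) :
    (β₀₁ : ZMod 2) + (β₂₃ : ZMod 2) = 1 := by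
  have h : ((β₀₁ + β₂₃ : ℤ) : ZMod 2) = ((2 * r + 1 : ℤ) : ZMod 2) := by rw [hr]
  have e2 : (2 : ZMod 2) = 0 := by decide
  simp only [Int.cast_add, Int.cast_mul, Int.cast_one, Int.cast_ofNat, e2, zero_mul, zero_add] at h
  exact h

end Cast

end Summit.Ventures.HSemireg.LeadingDigitCoverage
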